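import Summits.BirchSwinnertonDyer.BirchSwinnertonDyer.Theorems.KimAtThreeDeepLowerS24DeepOfPinned
import Summits.BirchSwinnertonDyer.Rank1Residual.GaloisImage.SakamotoN11InstanceFitting
import Literature.NumberTheory.GaloisCohomology.Sakamoto2024KolyvaginFittingIdeal
import HarnessLib

/-!
# S24-DEEP (2) (ORDER form) on the `3`-adic tower FROM THE PINNED [S24] FACTS, given one good core vertex;
# and the consumer package «one generator with its order relations» — the W2 deep rows' [S24] inputs with
# BOTH flagged ports replaced by Sakamoto 2024 Thm. 4.4 (1)(2) AS PRINTED plus kernel theorems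
# (route `KimAtThreeKolyvagin`, rung W2; cell `bsd-addord`, seat `bsd-addord-w2-c2` gen 5)

HONEST FRAMING. Theorems only (no definition, no named fact asserted, no `sorry`); nothing booked, no mark
moved; BSD is not proved by any of this. CONDITIONAL on the PUBLISHED pinned Literature facts
`Sakamoto2024.kolyvaginSystems_freeRankOne_zmod_three_pow` and
`Sakamoto2024.kolyvaginSystems_idealOfBasis_eq_fittingIdeal_zmod_three_pow` ([S24] Thm. 4.4 (1)(2) over `ℤ/3^m`
for Sakamoto's OWN prime set) in place of the flagged ports S24-DEEP (1)(2) (`S24-DEEP-PORT@3`), plus ONE good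
core vertex `n₀` of the deep class in the residual Kummer currency (`hn₀`, `hbot`; supplied on the W2 rows by
kim3 / w2-c3's `exists_goodCoreVertex_rat_three_deep` files). Sequel of `KimAtThreeDeepLowerS24DeepOfPinned`
(clause (1)); the same extension `D̂` / restriction bijection `KS₁(D̂) ≅ KS₁(D)` carries a basis of `KS₁(D)` to
a basis of `KS₁(D̂)` with the same values on the deep levels, where the pinned clause (2) under the tower
(n1011's `kolyvaginSystems_idealOfBasis_propagatedSelmerStructure_of_towerSurj`) applies verbatim.

* `exists_basis_restrict_eq` — pure algebra over `…S24DeepRestriction`: under the restriction bijection a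
  `zmultiples`-basis of `KS₁(D)` is the restriction of a `zmultiples`-basis of `KS₁(D̂)`.
* **`kolyvaginSystems_idealOfBasis_propagatedSelmerStructure_deep_of_pinned`** — binders of n1011's
  `…idealOfBasis…_deep_of_towerSurj` VERBATIM with `hS24d₂` replaced by the two pinned facts, plus `1 ≤ k`,
  `hn₀`, `hbot`; SAME conclusion.
* **`exists_generator_kolyvaginSystems_deep_of_pinned`** — n1011's consumer package
  `SakamotoN11InstanceDeepTower.exists_generator_kolyvaginSystems_deep_of_towerSurj` (ONE basis `κ` of
  `KS₁(E[3^k·3], 𝓕_can, 𝒫′)` of additive order `3^{k+1}`, ℕ-generating, with Thm. 4.4 (2) in ORDER form at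
  every level for every full-level Poitou–Tate family) with both ports replaced likewise.

References: R. Sakamoto, JTNB **36** (2024) Def. 4.2, Thm. 4.4 (1)(2) (p. 926), Prop. 7.7 [Sakamoto2024];
B. Mazur, K. Rubin, Mem. AMS **799** (2004) §3.5 (H.5), Cor. 4.5.2 (iv), Prop. A.2 [MazurRubin2004].
-/

set_option autoImplicit false
-- the Theorems namespace of a single-conjunct summit repeats the summit name by design (D-0017)
set_option linter.dupNamespace false

noncomputable section

open scoped Classical NumberField ContRepresentation
open Function Field NumberField IsDedekindDomain
open WeierstrassCurve Literature.NumberTheory.EllipticCurves Literature.NumberTheory.EllipticCurves.Rank1Residual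
  Literature.NumberTheory.GaloisRepresentations
  Literature.NumberTheory.GaloisRepresentations.DiscreteGaloisModule Literature.NumberTheory.GaloisCohomology

universe u

namespace Summit.BirchSwinnertonDyer.BirchSwinnertonDyer.Theorems.KimAtThreeDeepLowerS24DeepOrderOfPinned

open Summit.BirchSwinnertonDyer.Rank1Residual.GaloisImage
open Summit.BirchSwinnertonDyer.BirchSwinnertonDyer.Theorems.KimAtThreeDeepLowerS24DeepTower
open Summit.BirchSwinnertonDyer.BirchSwinnertonDyer.Theorems.KimAtThreeDeepLowerS24DeepRestriction
open Summit.BirchSwinnertonDyer.BirchSwinnertonDyer.Theorems.KimAtThreeDeepLowerS24DeepRigidity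
open Summit.BirchSwinnertonDyer.BirchSwinnertonDyer.Theorems.KimAtThreeDeepLowerS24DeepOfPinned
open Summit.BirchSwinnertonDyer.BirchSwinnertonDyer.Theorems.KimAtThreeShallowEqDeepGoodCoreVertex

/-! ### §1 A basis of `KS₁(D)` is the restriction of a basis of `KS₁(D̂)` -/

section Basis

variable {K : Type u} [Field K] [NumberField K] {M : Type u} [AddCommGroup M] [TopologicalSpace M]
  [DiscreteTopology M] {ρ : DiscreteGaloisModule K M}
  {D D' : KolyvaginDatum ρ} {𝓕 : SelmerStructure ρ}

/-- **Bases correspond under the restriction bijection**: under the hypotheses of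
`restrict_bijective_of_bijective_of_rigid`, every `zmultiples`-basis `κ` of `KS₁(D, 𝓕)` is the restriction of
a `zmultiples`-basis `κ̂` of `KS₁(D′, 𝓕)`: `κ̂_n = κ_n` at every level `n` of `D`. [cite: MazurRubin2004, §3.5 (H.5) and Cor. 4.5.2 (iv)]
[cite: Sakamoto2024, Thm. 4.4 (1)(2) (p. 926)] -/
theorem exists_basis_restrict_eq (hsub : D.primes ⊆ D'.primes)
    (htr : D.transverse = D'.transverse) (hfs : ∀ q ∈ D.primes, D.fs q = D'.fs q)
    {n₀ : Finset (HeightOneSpectrum (𝓞 K))} (hn₀ : D.IsLevel n₀)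
    (hbij : Function.Bijective fun κ : D'.kolyvaginSystems 𝓕 =>
      (⟨κ.1 n₀, ((KolyvaginDatum.mem_kolyvaginSystems_iff D' 𝓕 κ.1).mp κ.2).mem_selmerGroup n₀
        (isLevel_of_isLevel_of_subset hsub hn₀)⟩ : (D'.atLevel 𝓕 n₀).selmerGroup))
    (hrig : ∀ κ : Finset (HeightOneSpectrum (𝓞 K)) → galoisCohomology ρ 1,
      D.IsKolyvaginSystem 𝓕 κ → κ n₀ = 0 → ∀ n, κ n = 0)
    (κ : D.kolyvaginSystems 𝓕) (hκ : AddSubgroup.zmultiples κ = ⊤) :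
    ∃ κ' : D'.kolyvaginSystems 𝓕, AddSubgroup.zmultiples κ' = ⊤ ∧ ∀ n, D.IsLevel n → κ'.1 n = κ.1 n := by
  have hb := restrict_bijective_of_bijective_of_rigid hsub htr hfs hn₀ hbij hrig
  let r : D'.kolyvaginSystems 𝓕 →+ D.kolyvaginSystems 𝓕 :=
    { toFun := fun μ => ⟨fun n => if D.IsLevel n then μ.1 n else 0,
        isKolyvaginSystem_restrict hsub htr hfs ((KolyvaginDatum.mem_kolyvaginSystems_iff _ _ _).mp μ.2)⟩
      map_zero' := by
        apply Subtype.ext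
        funext n
        change (if D.IsLevel n then (0 : D'.kolyvaginSystems 𝓕).1 n else 0) = 0
        split_ifs <;> rfl
      map_add' := fun μ μ' => restrict_add hsub htr hfs μ μ' }
  have hrb : Function.Bijective r := hb
  let e : D'.kolyvaginSystems 𝓕 ≃+ D.kolyvaginSystems 𝓕 := AddEquiv.ofBijective r hrb
  refine ⟨e.symm κ, ?_, fun n hn => ?_⟩
  · rw [AddSubgroup.eq_top_iff']
    intro x
    have hx : e x ∈ AddSubgroup.zmultiples κ := by rw [hκ]; exact AddSubgroup.mem_top _
    obtain ⟨m, hm⟩ := AddSubgroup.mem_zmultiples_iff.mp hx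
    refine AddSubgroup.mem_zmultiples_iff.mpr ⟨m, ?_⟩
    rw [← map_zsmul e.symm, hm, e.symm_apply_apply]
  · have h := e.apply_symm_apply κ
    have h' := congrArg (fun y : D.kolyvaginSystems 𝓕 => y.1 n) h
    change (if D.IsLevel n then (e.symm κ).1 n else 0) = κ.1 n at h'
    rw [if_pos hn] at h'
    exact h'

end Basis

/-! ### §2 S24-DEEP (2) of pinned -/

variable (W : WeierstrassCurve ℚ) [W.IsElliptic]

/-- **S24-DEEP (2), ORDER form, under the `3`-adic tower from the PINNED [S24] Thm. 4.4 (1)(2), given one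
good core vertex**: for `1 ≤ k ≤ k′`, a datum `D` of `E[3^k·3]` on the deep class with cyclotomic transverse
conditions and canonical comparison, a full-level Poitou–Tate family `inv′`, a basis `κ` of `KS₁(D)` and a
level `d`: `ord(κ_d) · #H¹_{𝓕(d)^*}(ℚ, E[3^k·3]^∨(1)) = 3^{k+1}` if `#H¹_{𝓕(d)^*} ∣ 3^{k+1}`, and `κ_d = 0` if
`3^{k+1} ∣ #H¹_{𝓕(d)^*}` — the conclusion of n1011's `…idealOfBasis…_deep_of_towerSurj` with the port
`hS24d₂` replaced by the pinned facts. [cite: Sakamoto2024, Def. 4.2 and Thm. 4.4 (2) (p. 926), Prop. 7.7 (p. 936)]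
[cite: MazurRubin2004, §3.5 (H.5) (p. 27) and Cor. 4.5.2 (iv) (p. 48)] -/
theorem kolyvaginSystems_idealOfBasis_propagatedSelmerStructure_deep_of_pinned
    (hS24 : Sakamoto2024.kolyvaginSystems_freeRankOne_zmod_three_pow)
    (hS24₂ : Sakamoto2024.kolyvaginSystems_idealOfBasis_eq_fittingIdeal_zmod_three_pow) {k k' : ℕ} (hk : 1 ≤ k)
    (hkk' : k ≤ k')
    [Finite (geomTorsion W ((3 : ℕ) : ℤ))] [Finite (geomTorsion W (((3 : ℕ) : ℤ) ^ k * ((3 : ℕ) : ℤ)))]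
    [Finite (geomTorsion W (((3 : ℕ) : ℤ) ^ k' * ((3 : ℕ) : ℤ)))]
    (htower : ∀ n : ℕ, W.HasSurjectiveModNGaloisRep (3 ^ n : ℕ))
    (τ : absoluteGaloisGroup ℚ) (hτμ : τ ∈ rootsOfUnityFixer ℚ (3 ^ (k' + 1)))
    (hτq' : Nonempty (cokerSubOne (W.torsionGaloisModule (((3 : ℕ) : ℤ) ^ k' * ((3 : ℕ) : ℤ))) τ ≃+
      ZMod (3 ^ (k' + 1))))
    (inv : LocalInvariants ℚ 3) (hperf : inv.IsPerfect) (hsum : inv.SumLocalTermEqZero)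
    (hcompl : inv.SelmerComplement)
    (hEP : ∀ v : HeightOneSpectrum (𝓞 ℚ), localEulerPoincareCharacteristic (v.adicCompletion ℚ))
    (S : Finset (Place ℚ)) (hS : ∀ w : InfinitePlace ℚ, (Sum.inl w : Place ℚ) ∈ S)
    (h3S : ∀ v : HeightOneSpectrum (𝓞 ℚ), ((3 : ℕ) : 𝓞 ℚ) ∈ v.asIdeal → (Sum.inr v : Place ℚ) ∈ S)
    (hbadS : ∀ v : HeightOneSpectrum (𝓞 ℚ), ¬ W.HasGoodReductionAt v → (Sum.inr v : Place ℚ) ∈ S)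
    (D : KolyvaginDatum (W.torsionGaloisModule (((3 : ℕ) : ℤ) ^ k * ((3 : ℕ) : ℤ))))
    (η : (q : HeightOneSpectrum (𝓞 ℚ)) → (ZMod (Ideal.absNorm q.asIdeal))ˣ)
    (hP : D.primes = frobeniusClassPrimes (W.torsionGaloisModule (((3 : ℕ) : ℤ) ^ k' * ((3 : ℕ) : ℤ)))
      {v | (Sum.inr v : Place ℚ) ∈ S} τ (3 ^ (k' + 1)))
    (hT : D.transverse = cyclotomicTransverse (W.torsionGaloisModule (((3 : ℕ) : ℤ) ^ k * ((3 : ℕ) : ℤ))))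
    (hD : D.HasCanonicalComparison (3 ^ (k + 1)) η)
    {n₀ : Finset (HeightOneSpectrum (𝓞 ℚ))} (hn₀ : D.IsLevel n₀)
    (hbot : (inv.dualSelmerStructure (W.torsionGaloisModule ((3 : ℕ) : ℤ))
      ((W.kummerSelmerStructure ((3 : ℕ) : ℤ)).transverseAt
        (cyclotomicTransverse (W.torsionGaloisModule ((3 : ℕ) : ℤ))) n₀)).selmerGroup = ⊥)
    (inv' : LocalInvariants ℚ (3 ^ (k + 1))) (hperf' : inv'.IsPerfect)
    (hsum' : inv'.SumLocalTermEqZero) (hcompl' : inv'.SelmerComplement)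
    (κ : D.kolyvaginSystems (propagatedSelmerStructure W 3 k)) (hκ : AddSubgroup.zmultiples κ = ⊤)
    (d : Finset (HeightOneSpectrum (𝓞 ℚ))) (hd : D.IsLevel d) :
    (Nat.card (inv'.dualSelmerStructure (W.torsionGaloisModule (((3 : ℕ) : ℤ) ^ k * ((3 : ℕ) : ℤ)))
        (D.atLevel (propagatedSelmerStructure W 3 k) d)).selmerGroup ∣ 3 ^ (k + 1) →
      addOrderOf (κ.1 d) *
        Nat.card (inv'.dualSelmerStructure (W.torsionGaloisModule (((3 : ℕ) : ℤ) ^ k * ((3 : ℕ) : ℤ)))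
          (D.atLevel (propagatedSelmerStructure W 3 k) d)).selmerGroup = 3 ^ (k + 1)) ∧
    (3 ^ (k + 1) ∣ Nat.card (inv'.dualSelmerStructure
        (W.torsionGaloisModule (((3 : ℕ) : ℤ) ^ k * ((3 : ℕ) : ℤ)))
          (D.atLevel (propagatedSelmerStructure W 3 k) d)).selmerGroup → κ.1 d = 0) := by
  haveI : Fact (Nat.Prime 3) := ⟨Nat.prime_three⟩
  -- `k = j + 1`
  obtain ⟨j, rfl⟩ : ∃ j, k = j + 1 := ⟨k - 1, by omega⟩
  have hjk' : j ≤ k' := (Nat.le_succ j).trans hkk'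
  haveI hfinall : ∀ i : ℕ, Finite (geomTorsion W (((3 : ℕ) : ℤ) ^ i * ((3 : ℕ) : ℤ))) := fun i =>
    finite_geomTorsion_pow_mul W 3 i
  have h3 : W.HasSurjectiveModNGaloisRep ((3 : ℕ) : ℤ) := by simpa using htower 1
  have hunro : inv.UnramifiedOrthogonal :=
    UnramifiedCup.unramifiedOrthogonal_of_isPerfect inv Nat.prime_three.isPrimePow hperf
  -- the `τ`-data at every level `≤ k′`, and on `E[3]`
  have hτ : ∀ i, i ≤ k' → Nonempty (cokerSubOne (W.torsionGaloisModule (((3 : ℕ) : ℤ) ^ i * ((3 : ℕ) : ℤ))) τ ≃+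
      ZMod (3 ^ (i + 1))) := by
    intro i hi
    have hl' : ((3 : ℕ) : ℤ) ^ (k' + 1) = ((3 : ℕ) : ℤ) ^ k' * ((3 : ℕ) : ℤ) := pow_succ _ _
    have hl : ((3 : ℕ) : ℤ) ^ (i + 1) = ((3 : ℕ) : ℤ) ^ i * ((3 : ℕ) : ℤ) := pow_succ _ _
    have h1 : Nonempty (cokerSubOne (W.torsionGaloisModule (((3 : ℕ) : ℤ) ^ (k' + 1))) τ ≃+
        ZMod (3 ^ (k' + 1))) := by
      rw [hl']; exact hτq'
    have h := nonempty_cokerSubOne_equiv_zmod_pow_of_le W Nat.prime_three (Nat.succ_le_succ hi) τ h1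
    rw [hl] at h
    exact h
  have hτq₁ : Nonempty (cokerSubOne (W.torsionGaloisModule ((3 : ℕ) : ℤ)) τ ≃+ ZMod 3) := by
    have h := hτ 0 (Nat.zero_le _)
    have hl : ((3 : ℕ) : ℤ) ^ 0 * ((3 : ℕ) : ℤ) = ((3 : ℕ) : ℤ) := by rw [pow_zero, one_mul]
    rw [hl] at h
    simpa using h
  have hτμk : τ ∈ rootsOfUnityFixer ℚ (3 ^ (j + 1 + 1)) :=
    rootsOfUnityFixer_le_of_dvd ℚ (pow_dvd_pow 3 (Nat.succ_le_succ hkk')) hτμ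
  -- `η′` generating everywhere, `D` still canonical for `η′`
  obtain ⟨η', -, hη', hDη'⟩ := exists_eta_eq_on_primes_forall_zpowers_eq_top
    (W.torsionGaloisModule (((3 : ℕ) : ℤ) ^ (j + 1) * ((3 : ℕ) : ℤ))) hD
  -- (i) the extension `D̂` to the pinned class at level `k`, and the pinned fact for it under the tower
  haveI : NeZero (3 ^ (j + 1 + 1)) := ⟨pow_ne_zero _ three_ne_zero⟩
  obtain ⟨Dh, hPh, hTh, hfsh, hDh⟩ := exists_extension_to_frobeniusClassPrimes
    (W.torsionGaloisModule (((3 : ℕ) : ℤ) ^ (j + 1) * ((3 : ℕ) : ℤ))) {v | (Sum.inr v : Place ℚ) ∈ S}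
    hτμk (hτ (j + 1) hkk') D η' hη' hDη'
  have hsub : D.primes ⊆ Dh.primes := by
    rw [hP, hPh]
    exact S24Deep.frobeniusClassPrimes_torsion_pow_mul_mono W ((3 : ℕ) : ℤ) hkk' _ τ
      (pow_dvd_pow 3 (Nat.succ_le_succ hkk'))
  have htr : D.transverse = Dh.transverse := hTh.symm
  have hThc : Dh.transverse =
      cyclotomicTransverse (W.torsionGaloisModule (((3 : ℕ) : ℤ) ^ (j + 1) * ((3 : ℕ) : ℤ))) :=
    hTh.trans hT
  let T : Finset (HeightOneSpectrum (𝓞 ℚ)) := S.preimage Sum.inr Sum.inr_injective.injOn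
  have h3T : ∀ v : HeightOneSpectrum (𝓞 ℚ), ((3 : ℕ) : 𝓞 ℚ) ∈ v.asIdeal → v ∈ T :=
    fun v hv => Finset.mem_preimage.mpr (h3S v hv)
  have hbadT : ∀ v : HeightOneSpectrum (𝓞 ℚ), ¬ W.HasGoodReductionAt v → v ∈ T :=
    fun v hv => Finset.mem_preimage.mpr (hbadS v hv)
  have hpin := kolyvaginSystems_freeRankOne_propagatedSelmerStructure_of_towerSurj W hS24 (j + 1) htower τ
    hτμk (hτ (j + 1) hkk') inv hperf hsum hunro hcompl S hS
    (fun v hv => not_mem_and_isUnramifiedAt_of_not_mem W 3 (j + 1) S h3S hbadS hv)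
    (propagatedSelmerStructure_isUnramifiedOutside W 3 (j + 1) S hS h3S hbadS) (fun v _ => hEP v)
    (hasCoreRank_one_propagatedSelmerStructureOne_of_isPerfect_of_localEuler W inv hperf hsum hcompl hEP
      T h3T hbadT)
    Dh η' hPh hThc hDh
  -- (ii) the deep tower through `D`, the `E[3]`-datum on the deep class, and rigidity at `n₀`
  obtain ⟨Dt, hDtk, hDt⟩ := exists_deepTower_torsion_pow_mul W hkk' {v | (Sum.inr v : Place ℚ) ∈ S}
    hτμ hτ D η' hη' hP hT hDη'
  obtain ⟨D₁, hP₁, hT₁, hD₁⟩ := exists_deepDatum_torsion_three W k' {v | (Sum.inr v : Place ℚ) ∈ S}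
    hτμ hτq₁ η' hη'
  have hn₀' : D₁.IsLevel n₀ := fun q hq => by
    rw [hP₁]
    exact hP ▸ hn₀ hq
  have hbot₁ : (inv.dualSelmerStructure (W.torsionGaloisModule ((3 : ℕ) : ℤ))
      (D₁.atLevel (W.kummerSelmerStructure ((3 : ℕ) : ℤ)) n₀)).selmerGroup = ⊥ := by
    change (inv.dualSelmerStructure _ ((W.kummerSelmerStructure ((3 : ℕ) : ℤ)).transverseAt
      D₁.transverse n₀)).selmerGroup = ⊥
    rw [hT₁]
    exact hbot
  have hcore₁ : LocalInvariants.lambdaStar inv (D₁.atLevel (propagatedSelmerStructureOne W 3) n₀) 3 = 0 := by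
    have h0 := dualSelmerGroup_propagatedOne_atLevel_eq_bot_of_kummer W 3 inv D₁ n₀ hbot₁
    unfold LocalInvariants.lambdaStar
    rw [h0, AddSubgroup.card_bot, Nat.log_one_right]
  have hadm : ∀ i, i ≤ j + 1 → (Dt i).IsAdmissible := fun i hi =>
    isAdmissible_of_hasCanonicalComparison_torsion_deep W i k' (hi.trans hkk') {v | (Sum.inr v : Place ℚ) ∈ S}
      hτμ (hτ i (hi.trans hkk')) (hDt i (hi.trans hkk')).1 (hDt i (hi.trans hkk')).2.2
  have hrig : ∀ κ : Finset (HeightOneSpectrum (𝓞 ℚ)) →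
        galoisCohomology (W.torsionGaloisModule (((3 : ℕ) : ℤ) ^ (j + 1) * ((3 : ℕ) : ℤ))) 1,
      D.IsKolyvaginSystem (propagatedSelmerStructure W 3 (j + 1)) κ → κ n₀ = 0 → ∀ n, κ n = 0 := by
    intro κ hκ hκ₀ n
    have hκ' : (Dt (j + 1)).IsKolyvaginSystem (propagatedSelmerStructure W 3 (j + 1)) κ := by
      rw [hDtk]; exact hκ
    exact apply_eq_zero_of_apply_eq_zero_allDepths_le_deep W h3 hk hkk' τ hτμ hτq₁
      (fun i hi => hτ i (hi.trans hkk')) inv hperf hsum hunro hcompl hEP S hS h3S hbadS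
      (fun i _ P hP' => Transport.geomTorsion_eq_zero_of_fixed_of_surj W h3 i P fun σ => by
        have h := hP' σ
        rwa [torsionGaloisModule_apply_apply] at h)
      (TorsionLevel.geomTorsion_three_eq_zero_of_fixed_of_surj W h3) η' Dt D₁ hP₁ hT₁ hD₁
      (fun i hi => (hDt i (hi.trans hkk')).1) (fun i hi => (hDt i (hi.trans hkk')).2.1)
      (fun i hi => (hDt i (hi.trans hkk')).2.2) hadm hn₀' hcore₁ hκ' hκ₀ n
  -- the pinned bijectivity at `n₀` (a level of `D̂`; `λ^* = 0` there from the Kummer currency)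
  have hn₀h : Dh.IsLevel n₀ := isLevel_of_isLevel_of_subset hsub hn₀
  have hcorek : LocalInvariants.lambdaStar inv ((Dh.atLevel (propagatedSelmerStructure W 3 (j + 1)) n₀).induced
      (W.torsionMulBy (((3 : ℕ) : ℤ) ^ (j + 1)) ((3 : ℕ) : ℤ))) 3 = 0 :=
    lambdaStar_induced_atLevel_eq_zero_rat_three_deep W j hτμk (hτ (j + 1) hkk') (hτ j hjk') hτq₁ inv D₁
      Dh hPh.le hT₁ hThc hn₀h hbot₁
  have hbij₀ := hpin.2 n₀ hn₀h hcorek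
  -- the basis `κ̂` of `KS₁(D̂)` restricting to `κ`, and the pinned clause (2) for it at `d`
  have hunro' : inv'.UnramifiedOrthogonal :=
    UnramifiedCup.unramifiedOrthogonal_of_isPerfect inv'
      (Nat.prime_three.isPrimePow.pow (Nat.succ_ne_zero _)) hperf'
  obtain ⟨κh, hκh, hκhval⟩ := exists_basis_restrict_eq hsub htr hfsh hn₀ hbij₀ hrig κ hκ
  have hdh : Dh.IsLevel d := isLevel_of_isLevel_of_subset hsub hd
  have h2 := kolyvaginSystems_idealOfBasis_propagatedSelmerStructure_of_towerSurj W hS24₂ (j + 1) htower τ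
    hτμk (hτ (j + 1) hkk') inv hperf hsum hunro hcompl S hS
    (fun v hv => not_mem_and_isUnramifiedAt_of_not_mem W 3 (j + 1) S h3S hbadS hv)
    (propagatedSelmerStructure_isUnramifiedOutside W 3 (j + 1) S hS h3S hbadS) (fun v _ => hEP v)
    (hasCoreRank_one_propagatedSelmerStructureOne_of_isPerfect_of_localEuler W inv hperf hsum hcompl hEP
      T h3T hbadT)
    Dh η' hPh hThc hDh inv' hperf' hsum' hunro' hcompl' κh hκh d hdh
  rw [← atLevel_eq_of_transverse_eq htr d, hκhval d hd] at h2
  exact h2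

/-- **n1011's consumer package on the deep class WITHOUT the ports**: for `1 ≤ k ≤ k′` and a datum of
`E[3^k·3]` on the deep class (cyclotomic transverse, canonical comparison), given one good core vertex, there is
ONE Kolyvagin system `κ` which is a `zmultiples`-basis of `KS₁(E[3^k·3], 𝓕_can, 𝒫′)`, has additive order `3^{k+1}`,
ℕ-generates `KS₁`, AND satisfies [S24] Thm. 4.4 (2) in ORDER form at every level for every full-level Poitou–Tate
family — `SakamotoN11InstanceDeepTower.exists_generator_kolyvaginSystems_deep_of_towerSurj` with `hS24d`, `hS24d₂`
replaced by the pinned facts `hS24`, `hS24₂` (PUB). [cite: Sakamoto2024, Thm. 4.4 (1)(2) (p. 926)]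
[cite: MazurRubin2004, §3.5 (H.5) (p. 27) and Prop. A.2 (pp. 79–80)] -/
theorem exists_generator_kolyvaginSystems_deep_of_pinned
    (hS24 : Sakamoto2024.kolyvaginSystems_freeRankOne_zmod_three_pow)
    (hS24₂ : Sakamoto2024.kolyvaginSystems_idealOfBasis_eq_fittingIdeal_zmod_three_pow) {k k' : ℕ} (hk : 1 ≤ k)
    (hkk' : k ≤ k')
    [Finite (geomTorsion W ((3 : ℕ) : ℤ))] [Finite (geomTorsion W (((3 : ℕ) : ℤ) ^ k * ((3 : ℕ) : ℤ)))]
    [Finite (geomTorsion W (((3 : ℕ) : ℤ) ^ k' * ((3 : ℕ) : ℤ)))]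
    (htower : ∀ n : ℕ, W.HasSurjectiveModNGaloisRep (3 ^ n : ℕ))
    (τ : absoluteGaloisGroup ℚ) (hτμ : τ ∈ rootsOfUnityFixer ℚ (3 ^ (k' + 1)))
    (hτq' : Nonempty (cokerSubOne (W.torsionGaloisModule (((3 : ℕ) : ℤ) ^ k' * ((3 : ℕ) : ℤ))) τ ≃+
      ZMod (3 ^ (k' + 1))))
    (inv : LocalInvariants ℚ 3) (hperf : inv.IsPerfect) (hsum : inv.SumLocalTermEqZero)
    (hcompl : inv.SelmerComplement)
    (hEP : ∀ v : HeightOneSpectrum (𝓞 ℚ), localEulerPoincareCharacteristic (v.adicCompletion ℚ))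
    (S : Finset (Place ℚ)) (hS : ∀ w : InfinitePlace ℚ, (Sum.inl w : Place ℚ) ∈ S)
    (h3S : ∀ v : HeightOneSpectrum (𝓞 ℚ), ((3 : ℕ) : 𝓞 ℚ) ∈ v.asIdeal → (Sum.inr v : Place ℚ) ∈ S)
    (hbadS : ∀ v : HeightOneSpectrum (𝓞 ℚ), ¬ W.HasGoodReductionAt v → (Sum.inr v : Place ℚ) ∈ S)
    (D : KolyvaginDatum (W.torsionGaloisModule (((3 : ℕ) : ℤ) ^ k * ((3 : ℕ) : ℤ))))
    (η : (q : HeightOneSpectrum (𝓞 ℚ)) → (ZMod (Ideal.absNorm q.asIdeal))ˣ)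
    (hP : D.primes = frobeniusClassPrimes (W.torsionGaloisModule (((3 : ℕ) : ℤ) ^ k' * ((3 : ℕ) : ℤ)))
      {v | (Sum.inr v : Place ℚ) ∈ S} τ (3 ^ (k' + 1)))
    (hT : D.transverse = cyclotomicTransverse (W.torsionGaloisModule (((3 : ℕ) : ℤ) ^ k * ((3 : ℕ) : ℤ))))
    (hD : D.HasCanonicalComparison (3 ^ (k + 1)) η)
    {n₀ : Finset (HeightOneSpectrum (𝓞 ℚ))} (hn₀ : D.IsLevel n₀)
    (hbot : (inv.dualSelmerStructure (W.torsionGaloisModule ((3 : ℕ) : ℤ))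
      ((W.kummerSelmerStructure ((3 : ℕ) : ℤ)).transverseAt
        (cyclotomicTransverse (W.torsionGaloisModule ((3 : ℕ) : ℤ))) n₀)).selmerGroup = ⊥) :
    ∃ κ : D.kolyvaginSystems (propagatedSelmerStructure W 3 k),
      AddSubgroup.zmultiples κ = ⊤ ∧
      addOrderOf (κ.1 : Finset (HeightOneSpectrum (𝓞 ℚ)) →
        galoisCohomology (W.torsionGaloisModule (((3 : ℕ) : ℤ) ^ k * ((3 : ℕ) : ℤ))) 1) = 3 ^ (k + 1) ∧
      (∀ κ' ∈ D.kolyvaginSystems (propagatedSelmerStructure W 3 k), ∃ a : ℕ, κ' = a • κ.1) ∧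
      ∀ (inv' : LocalInvariants ℚ (3 ^ (k + 1))), inv'.IsPerfect → inv'.SumLocalTermEqZero →
        inv'.SelmerComplement →
        ∀ d, D.IsLevel d →
          (Nat.card (inv'.dualSelmerStructure _
              (D.atLevel (propagatedSelmerStructure W 3 k) d)).selmerGroup ∣ 3 ^ (k + 1) →
            addOrderOf (κ.1 d) * Nat.card (inv'.dualSelmerStructure _
              (D.atLevel (propagatedSelmerStructure W 3 k) d)).selmerGroup = 3 ^ (k + 1)) ∧
          (3 ^ (k + 1) ∣ Nat.card (inv'.dualSelmerStructure _
              (D.atLevel (propagatedSelmerStructure W 3 k) d)).selmerGroup → κ.1 d = 0) := by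
  haveI : NeZero (3 ^ (k + 1)) := ⟨pow_ne_zero _ three_ne_zero⟩
  obtain ⟨hfree, -⟩ := kolyvaginSystems_freeRankOne_propagatedSelmerStructure_deep_of_pinned W hS24 hk hkk'
    htower τ hτμ hτq' inv hperf hsum hcompl hEP S hS h3S hbadS D η hP hT hD hn₀ hbot
  obtain ⟨κ, hκ, hgo, hgen⟩ := exists_basis_of_isFreeRankOneZMod _ hfree
  exact ⟨κ, hκ, hgo, hgen, fun inv' hperf' hsum' hcompl' d hd =>
    kolyvaginSystems_idealOfBasis_propagatedSelmerStructure_deep_of_pinned W hS24 hS24₂ hk hkk' htower τ hτμ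
      hτq' inv hperf hsum hcompl hEP S hS h3S hbadS D η hP hT hD hn₀ hbot inv' hperf' hsum' hcompl' κ hκ d hd⟩

end Summit.BirchSwinnertonDyer.BirchSwinnertonDyer.Theorems.KimAtThreeDeepLowerS24DeepOrderOfPinned

end
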